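import Summits.BirchSwinnertonDyer.BirchSwinnertonDyer.Theorems.PrintCf2RubinValueTwoColemanCoinvariantCharGalois
import Literature.NumberTheory.EllipticCurves.PAdicTwoVariableUnitsClosureDensity
import Literature.NumberTheory.GaloisRepresentations.LubinTateColemanCoordCoinvariantNonvanishingTwo
import HarnessLib

/-!
# Brick (c) at `p = 2`, local `χ`-part — CAPSTONE for Artin-symbol index families: from the PRODUCT RULE `σ̃_a·β_c = β_{ac}·(β_a⁻¹)^{N c}`
# (de Shalit II §2.4 (ii) verbatim), density of the index symbols on the finite layers, two auxiliary indices and `L_ε ≠ 0`: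
# **`char_Λ ((N / Col 𝒞̄)_ε) = (L_ε)`**, `𝒞̄ = closure ⟨β_c^{±1}⟩`

Cell `bsd-print-cf2`, width seat `bsd-line-cf2c-w7` g14, route C `PrintCf2RubinValueTwo`, crux of record stmt-BirchSwinnertonDyer-24033
`TwoVariableMainConjAtSplitTwoQuad` (23720 nominal), BRICK §4(c); `--supports` the crux as a helper.  THEOREMS ONLY (0 sorry, no named fact, no
`def … : Prop`); Theses-free.  BSD is not proved by any of this.

`ColemanCoinvariantGalois.charIdeal_coinvariants_colemanImage_closure_eq_span_of_galois` (S24) takes two unit-side hypotheses about the Galois action: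
the LEVELWISE relation `(σ̃_c·β_{a,m})·β_{c,m}^{n_a} = (σ̃_a·β_{c,m})·β_{a,m}^{n_c}` and `hgen` (every translate `σ·β_c`, `σ ∈ Γ_F`, lies in `𝒞̄`).  For the
elliptic units both come from ONE printed identity, II §2.4 (ii) `σ_𝔠(β(𝔞)) = β(𝔞𝔠)·β(𝔠)^{−N𝔞}` (p. 66), plus the density of the Artin symbols on the
finite layers (`PAdicTwoVariableUnitsClosureDensity`, S25).  THIS file packages that:

* §1 ★ `hrel_of_mul_rule` — the product rule `σ̃_a·β_c = β_{μ(a,c)}·(β_a⁻¹)^{n_c}` with `μ` commutative IMPLIES the levelwise relation;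
* §1b ★ `ne_zero_iff_colemanDeltaCoinvFun_ne_zero_of_twistMul` — `L_ε ≠ 0 ↔ φ_ε(Col β_{a₁}) ≠ 0` (the factor at `a₁` is `C g·(T − b)`, a non-zero-divisor);
* §2 ★★★ **`charIdeal_coinvariants_colemanImage_closure_eq_span_of_mul_rule`** — `char_Λ ((N / Col 𝒞̄)_ε) = (L_ε)` from: principal coherent
  families `β_c`; indices `σ̃_c ∈ Γ_F` (arbitrary, with Amice pairs) satisfying the product rule and approximating every `σ ∈ Γ_F` on every layer
  `E_N·K_π^{N+1}`; `χ_π(σ̃_{a₁}) = γ`, `π ∣ n_{a₁} − 1`; one `a₂`; `L_ε ≠ 0` with `φ_ε(Col β_c) = (t_{χ(σ̃_c)}·C g_c − C n_c)·L_ε`;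
  ★★ `exists_charIdeal_coinvariants_colemanImage_closure_eq_span_of_mul_rule` — `L_ε` produced from the same data.

Remaining named inputs for de Shalit III (17) / Yager at one prime above `2`, unit side: the two-variable elliptic-unit principal coherent families
with the product rule for local lifts of the Artin symbols and the layer-approximation (Artin surjectivity); analytic side: `L_ε ≠ 0`
(`LubinTateColemanCoordCoinvariantNonvanishingTwo`).

## References
* [deShalit1987] E. de Shalit, *Iwasawa theory of elliptic curves with complex multiplication* (1987), II §2.4 (ii), §4.11 (p. 66), §4.12, §4.14;
  III §1.4 (5), Lemma 1.10 (17).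
* [Washington1997] L. C. Washington, *Introduction to Cyclotomic Fields* (1997), §13.2.
-/

noncomputable section

set_option linter.dupNamespace false
set_option autoImplicit false

open Filter Topology
open scoped PowerSeries.WithPiTopology

namespace Summit.BirchSwinnertonDyer.BirchSwinnertonDyer.Theorems.PrintCf2.ColemanCoinvariantArtin

open Literature.NumberTheory.GaloisRepresentations Literature.NumberTheory.GaloisRepresentations.IsNonarchimedeanLocalField
  Literature.NumberTheory.GaloisRepresentations.LubinTate ValuativeRel Field
open Literature.NumberTheory.EllipticCurves
open Literature.RingTheory.PowerSeries (maxEval)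
open Summit.BirchSwinnertonDyer.BirchSwinnertonDyer.Theorems.PrintCf2.ColemanImage
open Summit.BirchSwinnertonDyer.BirchSwinnertonDyer.Theorems.PrintCf2.ColemanCoinvariantGalois

variable {F : Type} [Field F] [ValuativeRel F] [TopologicalSpace F] [IsNonarchimedeanLocalField F]

attribute [local instance] ltNormUniformSpace ltNormIsUniformAddGroup rk1 nF nE fintypeResidueField
attribute [local instance] RelNormCoherentUnits.instCommMonoid

/-! ## §1. The product rule implies the levelwise relation -/

section MulRule

variable {π : 𝒪[F]} (hπ : (valuation F).IsUniformizer (π : F))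
variable (E : ℕ → IntermediateField F (AlgebraicClosure F)) [∀ m, FiniteDimensional F (E m)] [∀ m, Normal F (E m)]
variable {I : Type*} (β : I → ∀ m, RelNormCoherentUnits hπ (E m)) (τ : I → absoluteGaloisGroup F) (μ : I → I → I) (n : I → ℕ)

/-- ★ **II §2.4 (ii) in product form gives the symmetric levelwise relation**: from `σ̃_a·β_c = β_{μ(a,c)}·(β_a⁻¹)^{n_c}` (`μ` commutative),
`(σ̃_c·β_{a,m})·β_{c,m}^{n_a} = β_{μ(c,a),m} = β_{μ(a,c),m} = (σ̃_a·β_{c,m})·β_{a,m}^{n_c}`. [cite: deShalit1987, II §2.4 (ii), §4.11 (p. 66)] -/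
theorem hrel_of_mul_rule (hμ : ∀ a c, μ a c = μ c a)
    (hrule : ∀ a c : I, (fun m => ((β c) m).galAct (τ a)) = β (μ a c) * (fun m => ((β a) m).inv hπ (E m)) ^ n c)
    (a c : I) (m : ℕ) :
    ((β a) m).galAct (τ c) * (β c) m ^ n a = ((β c) m).galAct (τ a) * (β a) m ^ n c := by
  have key : ∀ a c : I, ((β c) m).galAct (τ a) * (β a) m ^ n c = β (μ a c) m := by
    intro a c
    have h := congrFun (hrule a c) m
    simp only [Pi.mul_apply, Pi.pow_apply] at h
    rw [h, mul_assoc, ← mul_pow]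
    have hinv : ((β a) m).inv hπ (E m) * (β a) m = 1 := by
      rw [mul_comm]; exact RelNormCoherentUnits.mul_inv hπ (E m) ((β a) m)
    rw [hinv, one_pow, mul_one]
  rw [key c a, key a c, hμ]

end MulRule

/-! ## §1b. `L_ε ≠ 0` read on the index `a₁` (two-variable frame) -/

section Nonvanishing

variable {π : 𝒪[F]} (hπ : (valuation F).IsUniformizer (π : F)) (hq : residueFieldCard F = 2)
variable {S : Type*} [CommRing S] (ι : LTCoeff F →+* S) [IsAdicComplete (Ideal.span {ι (LTCoeff.of F π)}) S]
variable (u : (LTCoeff F)ˣ) (hu : LTCoeff.of F π = residueFieldCard F * u) (γ : 𝒪[F]ˣ)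
variable (hreg : ∀ s : S, ι (LTCoeff.of F π) * s = 0 → s = 0) (w : 𝒪[F]ˣ) (hγ : (γ : 𝒪[F]) = 1 + π ^ 2 * w)
variable (ε : PowerSeries S)
variable [IsLocalRing S] [IsHausdorff (IsLocalRing.maximalIdeal S) S]

/-- ★ **`L_ε ≠ 0 ↔ φ_ε(x a₁) ≠ 0`** for the twisted factors: the factor at `a₁` is `C g_{a₁}·(T − b)` (`b = n_{a₁} g_{a₁}⁻¹ − 1 ∈ 𝔪_S`), a
non-zero-divisor — so the analytic input of the (c)-identity is the non-vanishing of `φ_ε(Col β_{a₁})` alone (one non-zero Coates–Wiles moment of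
parity `ε`, `LubinTateColemanCoordCoinvariantNonvanishingTwo`). [cite: deShalit1987, II §4.12 (32)–(33); III §1.4 Cor. 1.5] -/
theorem ne_zero_iff_colemanDeltaCoinvFun_ne_zero_of_twistMul {I : Type*} (x : I → ColemanCoordModule hπ hq ι u hu γ) (v : I → 𝒪[F]ˣ)
    (g : I → Sˣ) (n : I → S) (L : PowerSeries S)
    (hL : ∀ c : I, colemanDeltaCoinvFun hπ hq ι u hu γ hreg w hγ ε (x c) =
      (colemanDeltaCoinvFun hπ hq ι u hu γ hreg w hγ ε (unitTwistₗ hπ hq ι u hu γ (v c) (TActModule.ofPS _ _ 1)) *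
          PowerSeries.C (g c : S) - PowerSeries.C (n c)) * L)
    (a₁ : I) (hv₁ : v a₁ = γ) (hn₁ : n a₁ * ((g a₁)⁻¹ : Sˣ) - 1 ∈ IsLocalRing.maximalIdeal S) :
    L ≠ 0 ↔ colemanDeltaCoinvFun hπ hq ι u hu γ hreg w hγ ε (x a₁) ≠ 0 := by
  refine ne_zero_iff_apply_ne_zero_of_forall_eq_mul hL ?_
  have e₁ : colemanDeltaCoinvFun hπ hq ι u hu γ hreg w hγ ε (unitTwistₗ hπ hq ι u hu γ (v a₁) (TActModule.ofPS _ _ 1)) *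
        PowerSeries.C (g a₁ : S) - PowerSeries.C (n a₁) =
      PowerSeries.C (g a₁ : S) * (PowerSeries.X - PowerSeries.C (n a₁ * ((g a₁)⁻¹ : Sˣ) - 1)) := by
    rw [← sub_C_mul_inv_mul_C g n _ a₁, hv₁, colemanDeltaCoinvFun_unitTwistₗ_self_one_sub_C, one_mul, mul_comm]
  exact Literature.RingTheory.PowerSeries.mem_nonZeroDivisors_of_eq_unit_mul_X_sub_C hn₁ ((Units.isUnit (g a₁)).map PowerSeries.C) e₁

end Nonvanishing

/-! ## §2. The capstone -/

section Capstone

attribute [local instance] isAdicComplete_maximalIdeal_powerSeries_integer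

variable {p : ℕ} [hp : Fact p.Prime] {d : ℕ} (hd : d.Coprime p)
variable {π : 𝒪[F]} (hπ : (valuation F).IsUniformizer (π : F))
variable (E : ℕ → IntermediateField F (AlgebraicClosure F)) [∀ m, FiniteDimensional F (E m)] [∀ m, Normal F (E m)]
  [∀ m, IsGalois F (E m)] (hmono : Monotone E) (hE : ∀ m, E m ≤ maxUnramified F) (hdeg : ∀ m, Module.finrank F (E m) = d * p ^ m)
  {σ₀ : absoluteGaloisGroup F} (hσ₀ : IsAbsArithFrob σ₀) (hq : residueFieldCard F = 2)
variable (u : (LTCoeff F)ˣ) (hu : LTCoeff.of F π = residueFieldCard F * u) (γ w : 𝒪[F]ˣ) (hγ : (γ : 𝒪[F]) = 1 + π ^ 2 * w)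
variable [IsAdicComplete (Ideal.span {intBase F (LTCoeff.of F π)}) (PowerSeries 𝒪[F])] [NeZero d]
variable {θ : ∀ m, unitBall (E m)} (hθ : ∀ m, IsIntegralNormalGen (E m) (θ m))
  (hcoh : ∀ m, unitBallTrace (hmono (Nat.le_succ m)) (θ (m + 1)) = θ m)
variable [CharZero F] [IsAdicComplete (Ideal.span {(p : 𝒪[F])}) 𝒪[F]] (hI : Ideal.span {(p : 𝒪[F])} ≠ ⊤)
  (hud : ∀ m, (u : LTCoeff F) ^ Module.finrank F (E m) ≠ 1) (hm : ∃ m₁ : ℕ, LTCoeff.of F π ^ 2 ∣ LTCoeff.of F π - m₁)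
variable [Unique (ZMod d)] (hN : DenseRange (Nat.cast : ℕ → 𝒪[F]))
variable {I : Type*} (β : I → ∀ m, RelNormCoherentUnits hπ (E m)) (hβ : ∀ c, β c ∈ principalCoherentFamilies hπ E hmono)
variable (ε : PowerSeries (PowerSeries 𝒪[F])) (σ : I → absoluteGaloisGroup F) (g : I → (PowerSeries 𝒪[F])ˣ) (n : I → ℕ) (μ : I → I → I)
variable (hμ : ∀ a c, μ a c = μ c a)
  (hrule : ∀ a c : I, (fun m => ((β c) m).galAct (σ a)) = β (μ a c) * (fun m => ((β a) m).inv hπ (E m)) ^ n c)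
  (happrox : ∀ (τ : absoluteGaloisGroup F) (N : ℕ), ∃ a : I, ∀ z : (E N ⊔ ltField π N : IntermediateField F (AlgebraicClosure F)),
    σ a • (z : AlgebraicClosure F) = τ • (z : AlgebraicClosure F))

include hdeg hE hσ₀ hcoh hm hrule happrox in
/-- ★★★ **THE LOCAL (c)-IDENTITY FROM THE PRODUCT RULE** (de Shalit III Lemma 1.10 (17) at `q = 2`, one prime, `d = 1`, `ε`-part, for Artin-symbol index
families): `β_c ∈ 𝒰¹_∞` principal coherent; `σ̃_c ∈ Γ_F` with Amice units `g_c`, satisfying `σ̃_a·β_c = β_{μ(a,c)}·(β_a⁻¹)^{n_c}` (`μ` commutative) and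
approximating every `σ ∈ Γ_F` on every layer `E_N·K_π^{N+1}`; `χ_π(σ̃_{a₁}) = γ`; `b = n_{a₁} g_{a₁}⁻¹ − 1 ∈ 𝔪`; one `a₂` with non-zero Weierstrass value;
`L_ε ≠ 0` with `φ_ε(Col β_c) = (t_{χ(σ̃_c)}·C g_c − C n_c)·L_ε`.  Then **`char_Λ ((N / Col 𝒞̄)_ε) = (L_ε)`**, `𝒞̄ = closure ⟨β_c^{±1}⟩`.
[cite: deShalit1987, II §2.4 (ii), §4.12 (33), §4.14; III §1.4 (5), Cor. 1.5 (7), Lemma 1.10 (17)] [cite: Washington1997, §13.2] -/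
theorem charIdeal_coinvariants_colemanImage_closure_eq_span_of_mul_rule (hε : ε * ε = 1)
    (a₁ a₂ : I) (hv₁ : lubinTateChar hπ (σ a₁) = γ)
    (hn₁ : ((n a₁ : ℕ) : PowerSeries 𝒪[F]) * ((g a₁)⁻¹ : (PowerSeries 𝒪[F])ˣ) - 1 ∈ IsLocalRing.maximalIdeal (PowerSeries 𝒪[F]))
    (ha₂ : maxEval hn₁ (colemanDeltaCoinvFun hπ hq (intBase F) u hu γ (eq_zero_of_C_pi_mul_eq_zero_integer hπ) w hγ ε
        (unitTwistₗ hπ hq (intBase F) u hu γ (lubinTateChar hπ (σ a₂)) (TActModule.ofPS _ _ 1)) -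
      PowerSeries.C (((n a₂ : ℕ) : PowerSeries 𝒪[F]) * ((g a₂)⁻¹ : (PowerSeries 𝒪[F])ˣ))) ≠ 0)
    (L : PowerSeries (PowerSeries 𝒪[F])) (hL0 : L ≠ 0)
    (hL : ∀ c : I, colemanDeltaCoinvFun hπ hq (intBase F) u hu γ (eq_zero_of_C_pi_mul_eq_zero_integer hπ) w hγ ε
        (colemanImage hd hπ E hmono hE hdeg hσ₀ hq u hu γ hθ hcoh
          (closure_unitsGen_subset_principalCoherentFamilies hπ E hmono β hβ (mem_closure_unitsGen hπ E β c)).1 default) =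
      (colemanDeltaCoinvFun hπ hq (intBase F) u hu γ (eq_zero_of_C_pi_mul_eq_zero_integer hπ) w hγ ε
          (unitTwistₗ hπ hq (intBase F) u hu γ (lubinTateChar hπ (σ c)) (TActModule.ofPS _ _ 1)) *
          PowerSeries.C (g c : PowerSeries 𝒪[F]) - PowerSeries.C ((n c : ℕ) : PowerSeries 𝒪[F])) * L) :
    Module.charIdeal (PowerSeries (PowerSeries 𝒪[F]))
        (↥(unitsImage₁ hd hπ E hmono hE hdeg hσ₀ hq u hu γ hθ hcoh hI hud) ⧸
          colemanCoinvRel hπ hq (intBase F) u hu γ ε (unitsImage₁ hd hπ E hmono hE hdeg hσ₀ hq u hu γ hθ hcoh hI hud)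
            (fun _ hG => unitTwistₗ_mem_unitsImage₁ hd hπ E hmono hE hdeg hσ₀ hq u hu γ hθ hcoh hI hud (-1) hG)
            (colemanImageSubmodule₁ hd hπ E hmono hE hdeg hσ₀ hq u hu γ hθ hcoh hN
              (closure (Submonoid.closure (Set.range β ∪ Set.range fun c => fun m => ((β c) m).inv hπ (E m)) :
                Set (∀ m, RelNormCoherentUnits hπ (E m))))
              isClosed_closure (closure_unitsGen_subset_principalCoherentFamilies hπ E hmono β hβ) (one_mem_closure_unitsGen hπ E β)
              (mul_mem_closure_unitsGen hπ E β) (inv_mem_closure_unitsGen hπ E β)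
              (galAct_mem_closure_unitsGen hπ E β (galAct_mem_closure_unitsGen_of_mul_rule hπ E hmono β σ happrox μ n hrule)))) =
      Ideal.span {L} :=
  charIdeal_coinvariants_colemanImage_closure_eq_span_of_galois hd hπ E hmono hE hdeg hσ₀ hq u hu γ w hγ hθ hcoh hI hud hm hN β hβ
    (galAct_mem_closure_unitsGen_of_mul_rule hπ E hmono β σ happrox μ n hrule) ε σ g n hε a₁ a₂ hv₁ hn₁ ha₂ L hL0 hL

include hdeg hE hσ₀ hcoh hm hμ hrule happrox in
/-- ★★ **Existence form from the product rule**: with Amice pairs `(g_c, s_c)` of the `σ̃_c`, `χ_π(σ̃_{a₁}) = γ`, `π ∣ n_{a₁} − 1` and one `a₂`, THE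
series `L_ε` exists with `φ_ε(Col β_c) = (t_{χ(σ̃_c)}·C g_c − C n_c)·L_ε`, and — if `L_ε ≠ 0` — **`char_Λ ((N / Col 𝒞̄)_ε) = (L_ε)`** — unit-side inputs:
the product rule, commutativity of `μ`, the layer-approximation; nothing else. [cite: deShalit1987, II §2.4 (ii), §4.12 (29)–(33), §4.14; III §1.4 (5), Lemma 1.10 (17)] -/
theorem exists_charIdeal_coinvariants_colemanImage_closure_eq_span_of_mul_rule (hε : ε * ε = 1) (s : I → ZMod d)
    (hg : ∀ i m, ∃ a : ℕ, (∀ x : E m, σ i • (x : AlgebraicClosure F) = (σ₀ ^ a) • (x : AlgebraicClosure F)) ∧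
      ((1 + PowerSeries.X : PowerSeries 𝒪[F]) ^ p ^ m - 1) ∣ (g i : PowerSeries 𝒪[F]) - (1 + PowerSeries.X) ^ a ∧ (a : ZMod d) = s i)
    (a₁ a₂ : I) (hv₁ : lubinTateChar hπ (σ a₁) = γ) (hn₁ : (π : 𝒪[F]) ∣ (n a₁ : 𝒪[F]) - 1)
    (ha₂ : maxEval (natCast_mul_inv_sub_one_mem_maximalIdeal hπ hn₁ (g a₁) (constantCoeff_eq_one_of_amice E (p := p) (hg a₁)))
      (colemanDeltaCoinvFun hπ hq (intBase F) u hu γ (eq_zero_of_C_pi_mul_eq_zero_integer hπ) w hγ ε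
          (unitTwistₗ hπ hq (intBase F) u hu γ (lubinTateChar hπ (σ a₂)) (TActModule.ofPS _ _ 1)) -
        PowerSeries.C (((n a₂ : ℕ) : PowerSeries 𝒪[F]) * ((g a₂)⁻¹ : (PowerSeries 𝒪[F])ˣ))) ≠ 0) :
    ∃ L : PowerSeries (PowerSeries 𝒪[F]),
      (∀ c : I, colemanDeltaCoinvFun hπ hq (intBase F) u hu γ (eq_zero_of_C_pi_mul_eq_zero_integer hπ) w hγ ε
          (colemanImage hd hπ E hmono hE hdeg hσ₀ hq u hu γ hθ hcoh
            (closure_unitsGen_subset_principalCoherentFamilies hπ E hmono β hβ (mem_closure_unitsGen hπ E β c)).1 default) =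
        (colemanDeltaCoinvFun hπ hq (intBase F) u hu γ (eq_zero_of_C_pi_mul_eq_zero_integer hπ) w hγ ε
            (unitTwistₗ hπ hq (intBase F) u hu γ (lubinTateChar hπ (σ c)) (TActModule.ofPS _ _ 1)) *
            PowerSeries.C (g c : PowerSeries 𝒪[F]) - PowerSeries.C ((n c : ℕ) : PowerSeries 𝒪[F])) * L) ∧
      (L ≠ 0 → Module.charIdeal (PowerSeries (PowerSeries 𝒪[F]))
          (↥(unitsImage₁ hd hπ E hmono hE hdeg hσ₀ hq u hu γ hθ hcoh hI hud) ⧸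
            colemanCoinvRel hπ hq (intBase F) u hu γ ε (unitsImage₁ hd hπ E hmono hE hdeg hσ₀ hq u hu γ hθ hcoh hI hud)
              (fun _ hG => unitTwistₗ_mem_unitsImage₁ hd hπ E hmono hE hdeg hσ₀ hq u hu γ hθ hcoh hI hud (-1) hG)
              (colemanImageSubmodule₁ hd hπ E hmono hE hdeg hσ₀ hq u hu γ hθ hcoh hN
                (closure (Submonoid.closure (Set.range β ∪ Set.range fun c => fun m => ((β c) m).inv hπ (E m)) :
                  Set (∀ m, RelNormCoherentUnits hπ (E m))))
                isClosed_closure (closure_unitsGen_subset_principalCoherentFamilies hπ E hmono β hβ) (one_mem_closure_unitsGen hπ E β)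
                (mul_mem_closure_unitsGen hπ E β) (inv_mem_closure_unitsGen hπ E β)
                (galAct_mem_closure_unitsGen hπ E β (galAct_mem_closure_unitsGen_of_mul_rule hπ E hmono β σ happrox μ n hrule)))) =
        Ideal.span {L}) :=
  exists_charIdeal_coinvariants_colemanImage_closure_eq_span_of_galois hd hπ E hmono hE hdeg hσ₀ hq u hu γ w hγ hθ hcoh hI hud hm hN β hβ
    (galAct_mem_closure_unitsGen_of_mul_rule hπ E hmono β σ happrox μ n hrule) ε σ g n hε s hg
    (hrel_of_mul_rule hπ E β σ μ n hμ hrule) a₁ a₂ hv₁ hn₁ ha₂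

end Capstone

end Summit.BirchSwinnertonDyer.BirchSwinnertonDyer.Theorems.PrintCf2.ColemanCoinvariantArtin

end
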